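import Summits.QuantumFields.BalabanUV.Beta.D1BFx.ReducedKernelSandwichBlock
import Summits.QuantumFields.BalabanUV.Beta.D1BFx.GhostKernel

/-!
# `BalabanUV.Beta.D1BFx.GhostKernelSandwich` — road «BF-x» for binder row D1, sub-leaf A4-leg (part 4, END): LEAF-04's GHOST FINE
# ONE-SHOT KERNEL `GhostKernel.Pgh` IS AN `ℋ`-SANDWICH OF AN EXPLICIT BLOCK-PERIODIC FINE GHOST HESSIAN KERNEL `fineHessGh`, AND ITS
# COARSE BOND SECOND MOMENT IS THE BASE-POINT AVERAGE OF THE FINE ONE (K-R5, `X_n = 0`) GIVEN ONLY the Ward rows and the parity of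
# `fineHessGh` — every other input (ghost leg decay and block covariance, T6 stencil/table sockets) DISCHARGED for `0 < a`

HONEST DEPENDENCY (page 1, mandatory): continuum YM on T⁴ ⇐ BetaPertH ∧ nine spine estimates (0/9 proved); BetaPertH ⇐ (D1) ∧ (D4) ∧
CAP+tail; G-an2-4 gates asym, D1 and NE2/3/4.  HONEST FRAMING (cell contract, verbatim): «discharging `BetaPertH` makes Bałaban's UV
stability UNCONDITIONAL — a real constructive-QFT result; it is NOT the continuum limit and NOT the Clay problem.»  Two definitions with
bodies ([our object] `ghTab`, `fineHessGh`) and [folklore] bookkeeping BY NAME over parts 1–3 of this sub-leaf (`DressedTablesLeg`,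
`ReducedKernelSandwichLeg`, `ReducedKernelSandwichBlock`), leaf-04's T7-gh (`GhostKernel.Pgh`, `tableRedDiag`, `biLoc_smul'`,
`ghTable_translate`), the typer's T2/T6/T8-tab (`GhostLeg.spr_Ggh`/`shiftK_Ggh_neg`, `GhostStencil.biLoc_Sgh`/`Sgh_translate`/`biLoc_ghCnt`,
`ReducedTableF.tableRedF`) and K-R5.  HYPOTHESES THAT STAY HYPOTHESES (named, never minted): the per-entry ROW SUMS of `fineHessGh` (`hrow`
— the Ward identity of the ghost sector in kernel form, node A3.b; NOT proved here) and its base-point-summed FIRST MOMENTS (`hT1`) or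
affine INVERSION covariance (`hinv`) (node R5 (T1); NOT proved here).  SCOPE = T6 v1 (colour-stripped stencils; the `Q′(U)` second jets are
not in the table; the loop weight of leaf R1 is NOT applied — everything below is linear in the kernel, the caller's scalar passes through).
No `def … : Prop`, no citation; 0 binders of the hR root touched; nothing of D1 / BetaPertH discharged; NOT summit progress.
ABSOLUTE RULE (cell charter, verbatim): «No internally-minted statement may enter as a cited fact. Every hypothesis is either
kernel-proved in this package or a verbatim quotation of a PUBLISHED theorem with page reference. The manuscript(s) under audit are NOT
citable for their own disputed steps — they are the thing under adjudication; programme-internal (2001/route/tribunal) claims are never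
citable.»

CONTENT.
* §1 [our object] `ghTab cW κ′ u := cW • ghCnt κ′ u` (leaf-04's table argument, named); [folklore] `tableRedDiag_eq_tableRedF_diagExt`
  (leaf-04's collapsed dressing IS the typer's dressing of the diagonal extension — no hypothesis), **`Pgh_eq_TOfGh_tableRedF`**.
* §2 [folklore] the sockets of the ghost data at the common rate `1/n`: `biLoc_Sgh_one`, `biLoc_diagExt_ghTab`, `Sgh_translate_block`,
  `diagExt_ghTab_translate`, `diagExt_ghTab_symm`.
* §3 [our object] `fineHessGh n a cK cQ cW := fineHessA (Ggh n a) (Sgh n cK cQ) (diagExt (ghTab cW))`; [folklore] **`Pgh_eq_dressedEntryP`**,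
  **`bondSecondMoment_Pgh_eq_avgM2`**, `secondMoment_Pgh_eq`, **`bondSecondMoment_Pgh_eq_avgM2_of_inversion`**.
Unit `b2b-balaban-beta-d1-formalise-leaf-01` (gen 2).
-/

noncomputable section

namespace Summit.QuantumFields.BalabanUV.Beta.D1BFx.GhostKernelSandwich

open Finset
open scoped BigOperators
open Literature.MathematicalPhysics.QuantumFieldTheory.Balaban1983to89
open Literature.MathematicalPhysics.QuantumFieldTheory.Balaban1983to89.Beta
open B12Sec2to5 (l1 l1_nonneg)
open ExpKernelCalculus (Site MKer Decays BiLoc shiftK)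
open DecimatedMomentSummable (AbsMoment₂)
open DressedMomentNormalisation (EKer resSite)
open KernelSpecInstance (wH)
open MinimiserIdentityForm (wK)
open OneStepResolventKernel (wsum)
open Summit.QuantumFields.BalabanUV.Beta.TameKernelCalculus (Spr)
open Summit.QuantumFields.BalabanUV.Beta.D1BFx.GhostLeg (Ggh spr_Ggh shiftK_Ggh_neg)
open Summit.QuantumFields.BalabanUV.Beta.D1BFx.GhostStencil (Sgh ghCnt biLoc_Sgh Sgh_translate biLoc_ghCnt ghCnt_translate)
open Summit.QuantumFields.BalabanUV.Beta.D1BFx.ReducedKernelF (vertexRedF TOfLeg TOfGh)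
open Summit.QuantumFields.BalabanUV.Beta.D1BFx.ReducedTableF (tableRedF)
open Summit.QuantumFields.BalabanUV.Beta.D1BFx.GhostKernel (tableRedDiag Pgh biLoc_smul' shiftK_smul)
open Summit.QuantumFields.BalabanUV.Beta.D1BFx.MomentTransferPeriodic (baseKer)
open Summit.QuantumFields.BalabanUV.Beta.D1BFx.MomentTransferPeriodicEntry (EKer₂ dressedEntryP avgM2)
open Summit.QuantumFields.BalabanUV.Beta.D1BFx.ReducedKernelSandwichLeg (fineHessA)
open Summit.QuantumFields.BalabanUV.Beta.D1BFx.ReducedKernelSandwichBlock (diagExt tableRedF_diagExt_apply biLoc_diagExt diagExt_symm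
  diagExt_translate TOfLeg_tableRedF_eq_dressedEntryP_of_block bondSecondMoment_TOfLeg_eq_avgM2_of_block secondMoment_TOfLeg_eq_of_block
  bondSecondMoment_TOfLeg_eq_avgM2_of_inversion_of_block)

/-! ## §1 Leaf-04's ghost kernel in the typer's table slot -/

/-- [our object] The scaled ghost contact table of T7-gh, named: `ghTab cW κ′ u := cW • ghCnt κ′ u`.  A DEFINITION. -/
def ghTab (cW : ℝ) : Fin 4 → Site 4 → MKer 4 Unit := fun κ' u => cW • ghCnt κ' u

/-- [our object] Unfolding. -/
theorem ghTab_apply (cW : ℝ) (κ' : Fin 4) (u : Site 4) : ghTab cW κ' u = cW • ghCnt κ' u := rfl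

variable (n : ℕ) [NeZero n]

/-- [folklore] **LEAF-04's COLLAPSED DRESSING IS THE TYPER's DRESSING OF THE DIAGONAL EXTENSION**:
`tableRedDiag n T = tableRedF n (diagExt T)` (no hypothesis; `ReducedKernelSandwichBlock.tableRedF_diagExt_apply`). -/
theorem tableRedDiag_eq_tableRedF_diagExt {G : Type*} (T : Fin 4 → Site 4 → MKer 4 G) :
    tableRedDiag n T = tableRedF n (diagExt T) := by
  funext μ y ν y' x z a b
  rw [tableRedF_diagExt_apply]
  rfl

variable (a cK cQ cW : ℝ)

/-- [folklore] **`Pgh` IN THE GENERIC CHAIN'S FORMAT**: `Pgh n a cK cQ cW = TOfGh n a (Sgh n cK cQ) (tableRedF n (diagExt (ghTab cW)))`. -/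
theorem Pgh_eq_TOfGh_tableRedF : Pgh n a cK cQ cW = TOfGh n a (Sgh n cK cQ) (tableRedF n (diagExt (ghTab cW))) := by
  rw [← tableRedDiag_eq_tableRedF_diagExt]
  rfl

/-! ## §2 The sockets of the ghost data at the common rate `1/n` -/

/-- [folklore] T6's stencil socket at `δ := 1`: `BiLoc (Sgh n cK cQ κ′ u) u u (|cK|·e^{1/n} + |cQ|·(8/n³)·e⁸) (1/n)`. -/
theorem biLoc_Sgh_one (κ' : Fin 4) (u : Site 4) :
    BiLoc (Sgh n cK cQ κ' u) u u (|cK| * Real.exp (1 / n) + |cQ| * (8 / (n : ℝ) ^ 3 * Real.exp (8 * 1))) (1 / n) :=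
  biLoc_Sgh κ' u n cK cQ zero_le_one

omit [NeZero n] in
/-- [folklore] The diagonal extension of the scaled contact table is bi-localised at its two bonds at rate `1/n`
(`biLoc_ghCnt` + leaf-04's `biLoc_smul'` + `biLoc_diagExt`). -/
theorem biLoc_diagExt_ghTab (κ' : Fin 4) (u : Site 4) (l' : Fin 4) (u' : Site 4) :
    BiLoc (diagExt (ghTab cW) κ' u l' u') u u' (|cW| * Real.exp (2 * (1 / n))) (1 / n) :=
  biLoc_diagExt (ghTab cW) (fun κ' u => biLoc_smul' cW (biLoc_ghCnt κ' u (1 / (n : ℝ)))) (by positivity) κ' u l' u'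

omit [NeZero n] in
/-- [folklore] Block covariance of the scaled contact table (`ghCnt_translate` at block vectors). -/
theorem ghTab_translate (κ' : Fin 4) (u t : Site 4) :
    ghTab cW κ' (u + (n : ℤ) • t) = shiftK (-((n : ℤ) • t)) (ghTab cW κ' u) := by
  simp only [ghTab_apply, ghCnt_translate κ' u ((n : ℤ) • t), shiftK_smul]

omit [NeZero n] in
/-- [folklore] Block covariance of its diagonal extension. -/
theorem diagExt_ghTab_translate (κ' : Fin 4) (u : Site 4) (l' : Fin 4) (u' t : Site 4) :
    diagExt (ghTab cW) κ' (u + (n : ℤ) • t) l' (u' + (n : ℤ) • t) = shiftK (-((n : ℤ) • t)) (diagExt (ghTab cW) κ' u l' u') :=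
  diagExt_translate (ghTab cW) (fun t : Site 4 => (n : ℤ) • t) (fun κ' u t => ghTab_translate n cW κ' u t) κ' u l' u' t

/-- [folklore] Block covariance of T6's stencil (`Sgh_translate`, block vectors only). -/
theorem Sgh_translate_block (κ' : Fin 4) (u t : Site 4) :
    Sgh n cK cQ κ' (u + (n : ℤ) • t) = shiftK (-((n : ℤ) • t)) (Sgh n cK cQ κ' u) :=
  Sgh_translate κ' u n cK cQ t

/-! ## §3 The explicit fine ghost Hessian kernel; the sandwich; the moment transfer -/

/-- [our object] **THE FINE GHOST HESSIAN KERNEL** of T7-gh's data: `fineHessGh n a cK cQ cW := fineHessA (Ggh n a) (Sgh n cK cQ) (diagExt (ghTab cW))`,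
i.e. `(κ′,λ′,u,u′) ↦ ½·[(κ′,u) = (λ′,u′)]·cW·tadpole (Ggh) (ghCnt κ′ u) − ½·bubble (Ggh) (Sgh κ′ u) (Sgh λ′ u′)`.  A DEFINITION; the loop weight
of leaf R1 is NOT applied. -/
def fineHessGh (n : ℕ) [NeZero n] (a cK cQ cW : ℝ) : EKer₂ 4 := fineHessA (Ggh n a) (Sgh n cK cQ) (diagExt (ghTab cW))

/-- [our object] Unfolding. -/
theorem fineHessGh_eq : fineHessGh n a cK cQ cW = fineHessA (Ggh n a) (Sgh n cK cQ) (diagExt (ghTab cW)) := rfl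

/-- [folklore] **LEAF-04's GHOST FINE KERNEL IS AN `ℋ`-SANDWICH** (`0 < a`; NO other hypothesis):
`Pgh n a cK cQ cW μ ν z = dressedEntryP (wK n) (fineHessGh n a cK cQ cW) (n•(−z)) μ ν`. -/
theorem Pgh_eq_dressedEntryP (ha : 0 < a) (μ ν : Fin 4) (z : Site 4) :
    Pgh n a cK cQ cW μ ν z = dressedEntryP (wK n) (fineHessGh n a cK cQ cW) ((n : ℤ) • (-z)) μ ν := by
  have hn : (0 : ℝ) < 1 / (n : ℝ) := div_pos one_pos (by exact_mod_cast Nat.pos_of_ne_zero (NeZero.ne n))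
  rw [Pgh_eq_TOfGh_tableRedF, fineHessGh_eq]
  exact TOfLeg_tableRedF_eq_dressedEntryP_of_block n (Ggh n a) (spr_Ggh n a ha) (shiftK_Ggh_neg n a ha) (biLoc_Sgh_one n cK cQ)
    (biLoc_diagExt_ghTab n cW) hn (Sgh_translate_block n cK cQ) (diagExt_ghTab_translate n cW) μ ν z

/-- [folklore] **A4 FOR THE GHOST FINE KERNEL — THE DRESSING CROSS TERMS VANISH** (`0 < a`): GIVEN — hypotheses, the road's Ward (A3.b)
and parity (R5-(T1)) inputs for the ghost sector — that every entry of `fineHessGh n a cK cQ cW` has rows summing to zero and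
base-point-summed first moments zero, the coarse BOND second moment `Σ'_z z_κ z_λ · n⁸ · Pgh n a cK cQ cW μ ν z` EQUALS
`avgM2 n (fineHessGh n a cK cQ cW μ ν) κ λ` — the base-point average over one block of the fine second moment.  Node R5 for `P = Pgh`
with `X_n = 0`; every structural input (ghost leg decay/covariance, stencil/table sockets, symmetry) discharged from the tree. -/
theorem bondSecondMoment_Pgh_eq_avgM2 (ha : 0 < a)
    (hrow : ∀ (κ' l' : Fin 4) (b : Site 4), HasSum (fineHessGh n a cK cQ cW κ' l' b) 0)
    (hT1 : ∀ (κ' l' μ' : Fin 4),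
      ∑ r : Fin 4 → Fin n, ∑' t, (t μ' : ℝ) * baseKer (fineHessGh n a cK cQ cW κ' l') (resSite r) t = 0)
    (κ lam μ ν : Fin 4) :
    ∑' z : Site 4, ((z κ * z lam : ℤ) : ℝ) * ((n : ℝ) ^ 8 * Pgh n a cK cQ cW μ ν z)
      = avgM2 n (fineHessGh n a cK cQ cW μ ν) κ lam := by
  have hn : (0 : ℝ) < 1 / (n : ℝ) := div_pos one_pos (by exact_mod_cast Nat.pos_of_ne_zero (NeZero.ne n))
  rw [Pgh_eq_TOfGh_tableRedF]
  exact bondSecondMoment_TOfLeg_eq_avgM2_of_block n (Ggh n a) (spr_Ggh n a ha) (shiftK_Ggh_neg n a ha) (biLoc_Sgh_one n cK cQ)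
    (biLoc_diagExt_ghTab n cW) hn (Sgh_translate_block n cK cQ) (diagExt_ghTab_translate n cW)
    (fun κ' u l' u' => diagExt_symm (ghTab cW) κ' u l' u') hrow hT1 κ lam μ ν

/-- [folklore] The same in `B12Beta.secondMoment` currency: `Σ'_z Pgh n a cK cQ cW μ ν z · z_κ · z_λ = n⁻⁸ · avgM2 n (fineHessGh … μ ν) κ λ`. -/
theorem secondMoment_Pgh_eq (ha : 0 < a)
    (hrow : ∀ (κ' l' : Fin 4) (b : Site 4), HasSum (fineHessGh n a cK cQ cW κ' l' b) 0)
    (hT1 : ∀ (κ' l' μ' : Fin 4),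
      ∑ r : Fin 4 → Fin n, ∑' t, (t μ' : ℝ) * baseKer (fineHessGh n a cK cQ cW κ' l') (resSite r) t = 0)
    (κ lam μ ν : Fin 4) :
    ∑' z : Site 4, Pgh n a cK cQ cW μ ν z * (z κ : ℝ) * (z lam : ℝ)
      = ((n : ℝ) ^ 8)⁻¹ * avgM2 n (fineHessGh n a cK cQ cW μ ν) κ lam := by
  have hn : (0 : ℝ) < 1 / (n : ℝ) := div_pos one_pos (by exact_mod_cast Nat.pos_of_ne_zero (NeZero.ne n))
  rw [Pgh_eq_TOfGh_tableRedF]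
  exact secondMoment_TOfLeg_eq_of_block n (Ggh n a) (spr_Ggh n a ha) (shiftK_Ggh_neg n a ha) (biLoc_Sgh_one n cK cQ)
    (biLoc_diagExt_ghTab n cW) hn (Sgh_translate_block n cK cQ) (diagExt_ghTab_translate n cW)
    (fun κ' u l' u' => diagExt_symm (ghTab cW) κ' u l' u') hrow hT1 κ lam μ ν

/-- [folklore] **A4 FOR THE GHOST FINE KERNEL, PARITY BY INVERSION** (`0 < a`): the first-moment input replaced by an affine inversion
covariance of `fineHessGh` (bond reflection about the block centre; offsets may depend on the component). -/
theorem bondSecondMoment_Pgh_eq_avgM2_of_inversion (ha : 0 < a)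
    (hrow : ∀ (κ' l' : Fin 4) (b : Site 4), HasSum (fineHessGh n a cK cQ cW κ' l' b) 0)
    {a₁ a₂ : Fin 4 → Site 4}
    (hinv : ∀ (κ' l' : Fin 4) (s s' : Site 4),
      fineHessGh n a cK cQ cW κ' l' (a₁ κ' - s) (a₂ l' - s') = fineHessGh n a cK cQ cW κ' l' s s')
    (κ lam μ ν : Fin 4) :
    ∑' z : Site 4, ((z κ * z lam : ℤ) : ℝ) * ((n : ℝ) ^ 8 * Pgh n a cK cQ cW μ ν z)
      = avgM2 n (fineHessGh n a cK cQ cW μ ν) κ lam := by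
  have hn : (0 : ℝ) < 1 / (n : ℝ) := div_pos one_pos (by exact_mod_cast Nat.pos_of_ne_zero (NeZero.ne n))
  rw [Pgh_eq_TOfGh_tableRedF]
  exact bondSecondMoment_TOfLeg_eq_avgM2_of_inversion_of_block n (Ggh n a) (spr_Ggh n a ha) (shiftK_Ggh_neg n a ha)
    (biLoc_Sgh_one n cK cQ) (biLoc_diagExt_ghTab n cW) hn (Sgh_translate_block n cK cQ) (diagExt_ghTab_translate n cW)
    (fun κ' u l' u' => diagExt_symm (ghTab cW) κ' u l' u') hrow hinv κ lam μ ν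

end Summit.QuantumFields.BalabanUV.Beta.D1BFx.GhostKernelSandwich

end
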